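import Summits.MatrixMultiplication.MatrixMultiplication.Theses.SnSubsetDichotomy

/-!
# `SnSubsetDichotomy.Assembly` (stmt-MatrixMultiplication-10881) — threshold TPP subset triples and
Vershik–Kerov give `ω(ℂ) = 2`

Route `MatrixMultiplication/SnSubsetDichotomy`, item `stmt-MatrixMultiplication-10881` (assembly,
rank 1):

  `ThresholdSubsetTriples → VershikKerovBound → MatrixMultiplication`.

This is, verbatim, the type of the route's kernel-checked deciding theorem
`Summit.MatrixMultiplication.MatrixMultiplication.Theses.SnSubsetDichotomy.closes`; the proof below
replays that argument against the literal route decl without depending on `closes` itself (so the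
file survives any later re-authoring of the deciding theorem's proof script).

Argument (Cohn–Umans kill link).  `2 ≤ ω(ℂ)` is the flattening bound `omega_two_le`.  Suppose
`2 < ω := ω(ℂ)`.  `VershikKerovBound` gives `c₁ > 0`, `n₁` with `d_max(S_n) ≤ √(n!)·e^{-c₁√n}` for
`n ≥ n₁`.  Feed `c := 3c₁(ω − 2)/(2ω) > 0` and `n₁` to `ThresholdSubsetTriples`: some `n ≥ n₁`
carries a TPP triple `S, T, U ⊆ S_n` with `N := |S||T||U| > M := (n!)^{3/2}·e^{-c√n}`.  The
Cohn–Umans inequality (CKSU 2005, Cor. 1.9 — the tree THEOREM `CKSU2005_cor19_holds`) for the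
realised triple `⟨|S|, |T|, |U|⟩` in `S_n`, with `|S_n| = n!` and monotonicity of `x ↦ x^{ω-2}`,
gives `N^{ω/3} ≤ (√(n!)·e^{-c₁√n})^{ω-2}·n!`.  Taking logarithms,
`(ω/3)(3/2·log n! − c√n) < (ω/3)·log N ≤ (ω − 2)(½·log n! − c₁√n) + log n!`; the `log n!` terms
cancel (`(ω/3)·(3/2) = (ω − 2)/2 + 1`) and `(ω/3)·c = c₁(ω − 2)/2`, leaving
`−c₁(ω − 2)√n/2 < −c₁(ω − 2)√n`, i.e. `c₁(ω − 2)√n/2 < 0` — absurd since all three factors are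
non-negative.  Hence `ω ≤ 2`, so `ω(ℂ) = 2`, which is `MatrixMultiplication`
(`MatrixMultiplication_iff`).

References: H. Cohn, R. Kleinberg, B. Szegedy, C. Umans, *Group-theoretic algorithms for matrix
multiplication*, FOCS 2005, Cor. 1.9; H. Cohn, C. Umans, *A group-theoretic approach to fast matrix
multiplication*, FOCS 2003, Def. 2.1; A. M. Vershik, S. V. Kerov, *Asymptotic of the largest and the
typical dimensions of irreducible representations of a symmetric group*, Funct. Anal. Appl. 19
(1985), Thm. 1.
-/

-- single-conjunct summit: the mandated namespace `Summit.MatrixMultiplication.MatrixMultiplication.…`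
-- repeats `MatrixMultiplication` (summit = sub-problem), which `linter.dupNamespace` would flag.
set_option linter.dupNamespace false

namespace Summit.MatrixMultiplication.MatrixMultiplication.Theorems

open Summit.MatrixMultiplication.MatrixMultiplication.Theses.SnSubsetDichotomy in
/-- **Assembly of route SnSubsetDichotomy** (settles `stmt-MatrixMultiplication-10881`, exact route
signature `Summit.MatrixMultiplication.MatrixMultiplication.Theses.SnSubsetDichotomy.Assembly`):
threshold TPP subset triples in `S_n` (`ThresholdSubsetTriples`: for every `c > 0` beyond every `n₀`
a TPP triple `S, T, U ⊆ S_n` with `|S||T||U| > (n!)^{3/2}e^{-c√n}`) and the Vershik–Kerov bound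
(`VershikKerovBound`: `d_max(S_n) ≤ √(n!)e^{-c₁√n}` eventually) give `ω(ℂ) = 2`.  If `ω > 2`, take
`c := 3c₁(ω−2)/(2ω)`; CKSU 2005 Cor. 1.9 (tree theorem `CKSU2005_cor19_holds`) bounds
`(|S||T||U|)^{ω/3} ≤ d_max^{ω-2}·n! ≤ (√(n!)e^{-c₁√n})^{ω-2}·n!`, and after logarithms the two bounds
force `c₁(ω−2)√n/2 < 0`, absurd; `2 ≤ ω` is `omega_two_le`.  Same argument as the route's deciding
theorem `closes`, replayed here self-containedly.
[cite: CohnKleinbergSzegedyUmans2005, Cor. 1.9] [cite: VershikKerov1985, Thm. 1] -/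
theorem snSubsetDichotomy_assembly_proof :
    Summit.MatrixMultiplication.MatrixMultiplication.Theses.SnSubsetDichotomy.Assembly := by
  unfold Summit.MatrixMultiplication.MatrixMultiplication.Theses.SnSubsetDichotomy.Assembly
  intro hT hVK
  rw [_root_.MatrixMultiplication_iff]
  refine le_antisymm (not_lt.1 fun hlt => ?_)
    (Literature.Computability.AlgebraicComplexity.omega_two_le ℂ)
  -- Vershik–Kerov: d_max(S_n) ≤ √(n!)·exp(-c₁√n) for n ≥ n₁
  obtain ⟨c₁, hc₁, n₁, hn₁⟩ := hVK
  have hω0 : 0 < Literature.Computability.AlgebraicComplexity.omega ℂ := by linarith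
  have hω2 : 0 < Literature.Computability.AlgebraicComplexity.omega ℂ - 2 := by linarith
  -- the slack constant fed to the target
  obtain ⟨n, hn, S, T, U, hTPP, hbig⟩ := hT
    (3 * c₁ * (Literature.Computability.AlgebraicComplexity.omega ℂ - 2) /
      (2 * Literature.Computability.AlgebraicComplexity.omega ℂ))
    (by positivity) n₁
  -- Cohn–Umans (CKSU 2005 Cor. 1.9, tree theorem) for the realised triple ⟨|S|,|T|,|U|⟩ in S_n
  have hreal : Literature.Computability.AlgebraicComplexity.RealizesTPP (Equiv.Perm (Fin n))
      S.card T.card U.card := ⟨S, T, U, rfl, rfl, rfl, hTPP⟩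
  have hCU := Literature.Computability.AlgebraicComplexity.CKSU2005_cor19_holds
    (Equiv.Perm (Fin n)) S.card T.card U.card hreal
  have hVKn := hn₁ n hn
  have hcard : (Nat.card (Equiv.Perm (Fin n)) : ℝ) = (n.factorial : ℝ) := by
    rw [Nat.card_eq_fintype_card, Fintype.card_perm, Fintype.card_fin]
  rw [hcard] at hCU
  -- names
  set ω := Literature.Computability.AlgebraicComplexity.omega ℂ with hω
  set d : ℝ := (Literature.RepresentationTheory.FiniteGroups.maxCharDegree (Equiv.Perm (Fin n)) : ℝ)
    with hd
  set F : ℝ := (n.factorial : ℝ) with hF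
  set s : ℝ := Real.sqrt (n : ℝ) with hs
  set N : ℝ := ((S.card * T.card * U.card : ℕ) : ℝ) with hN
  have hF0 : 0 < F := by rw [hF]; exact_mod_cast n.factorial_pos
  have hs0 : 0 ≤ s := Real.sqrt_nonneg _
  have hd0 : 0 ≤ d := Nat.cast_nonneg _
  set D : ℝ := Real.sqrt F * Real.exp (-(c₁ * s)) with hD
  have hD0 : 0 < D := by positivity
  set c : ℝ := 3 * c₁ * (ω - 2) / (2 * ω) with hc
  set M : ℝ := F ^ ((3 : ℝ) / 2) * Real.exp (-(c * s)) with hM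
  have hM0 : 0 < M := by positivity
  have hN0 : 0 < N := hM0.trans hbig
  -- upper bound: N^{ω/3} ≤ D^{ω-2} · n!
  have hup : N ^ (ω / 3) ≤ D ^ (ω - 2) * F := by
    refine hCU.trans ?_
    exact mul_le_mul_of_nonneg_right (Real.rpow_le_rpow hd0 hVKn hω2.le) hF0.le
  -- logarithms of both bounds
  have hlogup : ω / 3 * Real.log N ≤ (ω - 2) * (Real.log F / 2 + -(c₁ * s)) + Real.log F := by
    have h1 : Real.log (N ^ (ω / 3)) ≤ Real.log (D ^ (ω - 2) * F) :=
      Real.log_le_log (Real.rpow_pos_of_pos hN0 _) hup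
    rw [Real.log_rpow hN0, Real.log_mul (Real.rpow_pos_of_pos hD0 _).ne' hF0.ne',
      Real.log_rpow hD0, hD, Real.log_mul (Real.sqrt_pos.2 hF0).ne' (Real.exp_pos _).ne',
      Real.log_sqrt hF0.le, Real.log_exp] at h1
    exact h1
  have hloglow : ω / 3 * Real.log M < ω / 3 * Real.log N :=
    mul_lt_mul_of_pos_left (Real.log_lt_log hM0 hbig) (by positivity)
  have hlogM : Real.log M = (3 : ℝ) / 2 * Real.log F + -(c * s) := by
    rw [hM, Real.log_mul (Real.rpow_pos_of_pos hF0 _).ne' (Real.exp_pos _).ne', Real.log_rpow hF0,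
      Real.log_exp]
  rw [hlogM] at hloglow
  -- the arithmetic: ω·c/3 = c₁(ω-2)/2, so the two bounds force c₁(ω-2)√n/2 < 0
  have hkey : ω / 3 * (c * s) = c₁ * (ω - 2) * s / 2 := by
    rw [hc]
    field_simp
  have hnn : 0 ≤ c₁ * (ω - 2) * s := mul_nonneg (mul_nonneg hc₁.le hω2.le) hs0
  nlinarith [hkey, hnn, hloglow, hlogup]

end Summit.MatrixMultiplication.MatrixMultiplication.Theorems
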